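/-
Copyright (c) 2026. All rights reserved.
Released under Apache 2.0 license as described in the file LICENSE.
-/
import Literature.AlgebraicGeometry.ComplexMultiplication.HyperellipticJacobianPrimePowerMumfordTateLattice
import HarnessLib

/-!
# `MT(J_{15}) → MT(X_{15})` is an isogeny of degree EXACTLY `2`, not an isomorphism (Goodson 2024, Prop. 5.4;
# Gallese–Goodson–Lombardo 2024, §1): the character lattice of the Jacobian family of level `15`

Layer `Literature/AlgebraicGeometry/ComplexMultiplication`, namespace `…ComplexMultiplication.HyperellipticJacobian`; the CONTRAST file
to `HyperellipticJacobianPrimePowerMumfordTateLattice` (for `m = p^k` every integral character of `⊔_i Hom(ℚ(ζ_{d_i}), ℂ)` is a character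
of the top factor modulo the equations — the projection of Mumford–Tate groups is an ISOMORPHISM) and to
`HyperellipticJacobianExceptionalClasses` §6 (`cmFamilyRank_eq_cmTypeRank_fifteen`: for `m = 15` the ranks agree, `5 = 5` — an
ISOGENY; «the degree `2` is not typed»).  THIS FILE types the degree: on the CM data of `J_{15} ∼ X_{15} × J_5 × J_3` the subgroup
`ℤ[Hom(ℚ(ζ_{15}), ℂ)] + {equations}` of `ℤ[⊔_d Hom(ℚ(ζ_d), ℂ)]` — whose index is the order of the kernel of `MT(J_{15}) → MT(X_{15})`
(Goodson's Lemma 3.2 = Lombardo's criterion, the dictionary of the companion file) — has index EXACTLY `2`.  Same definition-free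
language: `v_τ = translateInd Σ τ` (translates of Deligne's total type `Σ = ⊔_i Φ_i`), `w_τ` its top component, integral characters
`f` paired against them.  THEOREMS ONLY (no definition, no named fact, no `sorry`, no instance); the finite facts are kernel-`decide`d.

## The print

* H. Goodson, *An exploration of degeneracy in abelian varieties of Fermat type*, Exp. Math. **34** (2024) [Goodson2024DegeneracyFermat]
  (held `paper:arxiv-2211.03909`, read first-hand p0007–p0008, p0013): §3.1.2 LEMMA 3.2 (after Lombardo 2021 Lemma 4.2): «The canonical
  projection `π_i` is an isomorphism if and only if `T̂_i + ker(N_1^*φ_1^* + ⋯ + N_n^*φ_n^*) = T̂_{E_1} × ⋯ × T̂_{E_n}`. Similarly, `π_i` is an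
  isogeny if and only if `T̂_i + ker(…)` has finite index», proof: «`M̂T(A_1 × ⋯ × A_n)` can be identified with
  `(T̂_{E_1} × ⋯ × T̂_{E_n}) / ker(N_1^*φ_1^* + ⋯ + N_n^*φ_n^*)`»; §5.2.1 (`J_{15} ∼ X × J_5 × J_3`, `L = E_1 = ℚ(ζ_{15})`, `E_2 = ℚ(ζ_5)`,
  `E_3 = ℚ(ζ_3)`, rows `G = {τ_1, τ_2, τ_4, τ_7, τ_8, τ_{11}, τ_{13}, τ_{14}}`, the `8 × (8+4+2)` matrix `M = (M_1 | M_2 | M_3)` of eq.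
  (MTmatrix15)); PROPOSITION 5.4: «The canonical projection `MT(J_{15}) → X` is a degree 2 isogeny.  Proof. We use Sage to compute the
  (right) kernel of the matrix `M` … the space spanned by kernel of `M` and `ℤ⁸ × {0} × {0}` is an index-2 submodule of `ℤ⁸ × ℤ⁴ × ℤ²`.
  This corresponds to `T̂_1 × {0} × {0} + ker(N_1^*φ_1^* + N_2^*φ_2^* + N_3^*φ_3^*)` having index 2 … Thus, by Lemma 3.2, the projection is a
  degree 2 isogeny.»
* A. Gallese, H. Goodson, D. Lombardo (arXiv:2405.20394) [GalleseGoodsonLombardo2024] §1 «Results in families» (held p0005): «for `m = 15`,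
  the simple factors of `J_{15}` are all nondegenerate but the projection of the Mumford–Tate group is an isogeny, not an isomorphism».

## What is proved (levels `1 < d_i ∣ 15`, one of them `d_{i₀} = 15`, lower-half types `Φ_i` — hypothesis `hΦ`; a LOWER embedding is a
`z = (i, y)` with `d_i ≠ 15`, i.e. `d_i ∈ {3, 5}`; `u = u_{15}(τ) ∈ (ℤ/15)ˣ` the top cyclotomic character of `τ ∈ Aut(ℂ)`)

* §1 (the «Sage computation», by `decide` on residues; Goodson's matrix read column by column):
  `decide_top_cover_even` — summed over the rows `u ∈ {1, 2, 4, 7}` every top column `[2⟨ua⟩ < 15]`, `a ∈ (ℤ/15)ˣ`, is EVEN;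
  `decide_lower_cover_odd` — every lower column `[2⟨ub⟩_d < d]`, `(d, b) ∈ {(3,1),(3,2),(5,1),…,(5,4)}`, summed over the same rows is ODD;
  `decide_exists_lower_sub_table` — an integer table `G(d,b,·)` on `(ℤ/15)ˣ` with `[2⟨ub⟩_d < d] − [2⟨u⟩_5 < 5] = Σ_a G(d,b,a)[2⟨ua⟩ < 15]`
  for all `u` (`G(3,1) = −δ_2+δ_4`, `G(3,2) = −δ_1+δ_8`, `G(5,1) = 0`, `G(5,2) = −δ_1+δ_4`, `G(5,3) = −δ_2+δ_8`, `G(5,4) = −δ_1−δ_2+δ_4+δ_8`);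
  `decide_exists_two_mul_table` — `2[2⟨u⟩_5 < 5] = Σ_a G₂(a)[2⟨ua⟩ < 15]`, `G₂ = δ_2 + δ_7 + δ_{11} − δ_{14}`.
* §2 (plumbing): `sum_embeddings_eq_sum_filter_coprime` (sums over `Hom(ℚ(ζ_N), ℂ)` = sums over `(ℤ/N)ˣ`);
  `translateInd_familyType_eq_ite_val` ∕ `translateInd_top_eq_ite_val` ∕ `_fifteen` (`v_τ(i, σ) = [2((u·e(σ)) mod d_i) < d_i]`);
  `sum_top_pairing_eq` (`⟨g, w_τ⟩` for `g = F ∘ e` as a sum over the eight units).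
* §3: **`not_exists_top_character_fifteen`** — for EVERY lower embedding `z`: NO `g : Hom(ℚ(ζ_{15}), ℂ) → ℤ` has `[τ∘z ∈ Σ] = ⟨g, w_τ⟩`
  for all `τ` (`δ_z ∉ ℤ[E_{15}] + {equations}`: **the projection is NOT an isomorphism** — the mod-2 obstruction);
  `exists_rows_fifteen` (top `δ`'s and differences of lower `δ`'s ARE represented), `exists_top_character_two_mul_fifteen` (`2δ_{z₀}` is
  represented); **`exists_top_character_or_fifteen`** — for any fixed lower `z₀`, EVERY `f : ⊔ Hom → ℤ` satisfies `⟨f, v_τ⟩ = ⟨g, w_τ⟩ ∀τ`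
  or `⟨f, v_τ⟩ = ⟨g, w_τ⟩ + v_τ(z₀) ∀τ` for some integral top character `g` (the quotient is generated by `δ_{z₀}` and killed by `2`);
  **`index_two_fifteen`** — both halves: **PROPOSITION 5.4, the index ∕ the degree of the isogeny `MT(J_{15}) → MT(X_{15})` is EXACTLY `2`**.

## Honest column / NOT here

* As in the companions the tori are not constructed; «degree of the isogeny = index of `T̂_1 + ker` = order of
  `ℤ[S]/(ℤ[E_{15}] + {equations})`» is Goodson's Lemma 3.2 (Lombardo), quoted as the dictionary; what is proved is the index statement
  on Deligne's index set, in the elementary form «every character is ≡ 0 or ≡ δ_{z₀}, and δ_{z₀} ≢ 0».  The hypotheses allow the families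
  `{15, 5, 3}` (Goodson's `J_{15}`), `{15, 5}` and `{15, 3}` (distinct levels, `hinj`); all have index `2`.
* `m = 21` (Prop. 5.6: `MT(J_{21}) → MT(X_{21})` is not even an isogeny — rank `7 > 6`, typed in `HyperellipticJacobianExceptionalClasses`
  §7 ∕ §9) and general `m = pq` are not treated here; nothing here is an algebraicity statement; `HC_CM` is not touched.

## References

* [Goodson2024DegeneracyFermat] H. Goodson, Exp. Math. 34 (2024) 290–306 (arXiv:2211.03909) — §3.1.2 Lemmas 3.1–3.2, §5.2.1 eq.
  (Galois15), (MTmatrix15), Prop. 5.4.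
* [GalleseGoodsonLombardo2024] A. Gallese, H. Goodson, D. Lombardo, arXiv:2405.20394 — §1 «Results in families»; §4.1 Prop. 19.
* D. Lombardo, Trans. Amer. Math. Soc. 376 (2023) [MR4557876] — Lemmas 4.1–4.2 (through Goodson §3.1.2 and GGL §4.1).
* [Washington1997] L. C. Washington, GTM 83 — Thm. 2.5.  [Deligne1982HodgeCycles] — I Ex. 3.7 (c).

## Provenance

Cell `pub-hodgecm2` (COR-CM), KEPT Literature lane `lit-deligne-3` gen 50 (claim GOODSON-54-DEGREE-TWO; count-neutral, own lane);
the «v2 target» announced with the companion (HOME INBOX l.28654).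
-/

noncomputable section

open NumberField

namespace Literature.AlgebraicGeometry.ComplexMultiplication

namespace HyperellipticJacobian

/-! ## §1 The decided kernels on residues (the «Sage computation» of Prop. 5.4, by `decide`) -/

section Kernels

/-- The units of `ℤ/15` as natural numbers `< 15`. [folklore] -/
private theorem filter_coprime_fifteen :
    ((Finset.range 15).filter fun a => a.Coprime 15) = ({1, 2, 4, 7, 8, 11, 13, 14} : Finset ℕ) := by decide

/-- **The mod-`2` obstruction, top half: the four translates by `u ∈ {1, 2, 4, 7}` cover every embedding of `ℚ(ζ₁₅)` an EVEN
number of times** — `Σ_{u ∈ {1,2,4,7}} [2⟨ua⟩ < 15] ∈ 2ℤ` for every unit `a` (the columns of Goodson's matrix `M_1` summed over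
the rows `τ_1, τ_2, τ_4, τ_7` are even).  [cite: Goodson2024DegeneracyFermat, §5.2.1 eq. (MTmatrix15) and Prop. 5.4 (the Sage computation)] -/
theorem decide_top_cover_even :
    ∀ a ∈ ({1, 2, 4, 7, 8, 11, 13, 14} : Finset ℕ),
      ((if 2 * ((1 * a) % 15) < 15 then 1 else 0) + (if 2 * ((2 * a) % 15) < 15 then 1 else 0) +
          (if 2 * ((4 * a) % 15) < 15 then 1 else 0) + (if 2 * ((7 * a) % 15) < 15 then 1 else 0) : ℕ) =
        2 * ((((if 2 * ((1 * a) % 15) < 15 then 1 else 0) + (if 2 * ((2 * a) % 15) < 15 then 1 else 0) +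
          (if 2 * ((4 * a) % 15) < 15 then 1 else 0) + (if 2 * ((7 * a) % 15) < 15 then 1 else 0) : ℕ)) / 2) := by
  decide

/-- **The mod-`2` obstruction, lower half: the same four translates cover every embedding of `ℚ(ζ₅)` and of `ℚ(ζ₃)` an ODD number
of times** — `Σ_{u ∈ {1,2,4,7}} [2⟨ub⟩_d < d]` is odd for `d ∈ {3, 5}` and every unit `b` modulo `d` (the columns of `M_2`, `M_3`).
[cite: Goodson2024DegeneracyFermat, §5.2.1 eq. (MTmatrix15) and Prop. 5.4 (the Sage computation)] -/
theorem decide_lower_cover_odd :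
    ∀ p ∈ ({(3, 1), (3, 2), (5, 1), (5, 2), (5, 3), (5, 4)} : Finset (ℕ × ℕ)),
      (((if 2 * ((1 * p.2) % p.1) < p.1 then 1 else 0) + (if 2 * ((2 * p.2) % p.1) < p.1 then 1 else 0) +
          (if 2 * ((4 * p.2) % p.1) < p.1 then 1 else 0) + (if 2 * ((7 * p.2) % p.1) < p.1 then 1 else 0) : ℕ)) % 2 = 1 := by
  decide

/-- **The representations: every difference of two lower coordinate characters is a top character on the family.**  There is an
INTEGER table `G(d, b, ·)` on the units of `ℤ/15` with `[2⟨ub⟩_d < d] − [2⟨u⟩_5 < 5] = Σ_a G(d,b,a)·[2⟨ua⟩ < 15]` for every unit `u`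
and every lower coordinate `(d, b)`, `d ∈ {3,5}` (so `δ_{(d,b)} − δ_{(5,1)}`, hence any `δ_z − δ_{z'}` with `z, z'` lower, pairs with
all translates like a top character).  Table: `G(3,1) = −δ_2 + δ_4`, `G(3,2) = −δ_1 + δ_8`, `G(5,1) = 0`, `G(5,2) = −δ_1 + δ_4`,
`G(5,3) = −δ_2 + δ_8`, `G(5,4) = −δ_1 − δ_2 + δ_4 + δ_8`.  [cite: Goodson2024DegeneracyFermat, §5.2.1 Prop. 5.4 (the kernel of `M`, by Sage)] -/
theorem decide_exists_lower_sub_table :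
    ∃ G : ℕ → ℕ → ℕ → ℤ,
      ∀ p ∈ ({(3, 1), (3, 2), (5, 1), (5, 2), (5, 3), (5, 4)} : Finset (ℕ × ℕ)),
        ∀ u ∈ ({1, 2, 4, 7, 8, 11, 13, 14} : Finset ℕ),
          ((if 2 * ((u * p.2) % p.1) < p.1 then 1 else 0) - (if 2 * (u % 5) < 5 then 1 else 0) : ℤ) =
            ∑ a ∈ ({1, 2, 4, 7, 8, 11, 13, 14} : Finset ℕ), G p.1 p.2 a * (if 2 * ((u * a) % 15) < 15 then 1 else 0) := by
  refine ⟨fun d b a =>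
    if d = 3 then
      (if b = 1 then (if a = 2 then -1 else if a = 4 then 1 else 0) else (if a = 1 then -1 else if a = 8 then 1 else 0))
    else
      (if b = 1 then 0
       else if b = 2 then (if a = 1 then -1 else if a = 4 then 1 else 0)
       else if b = 3 then (if a = 2 then -1 else if a = 8 then 1 else 0)
       else (if a = 1 then -1 else if a = 2 then -1 else if a = 4 then 1 else if a = 8 then 1 else 0)), ?_⟩
  decide

/-- **Twice the base lower character is a top character**: `2·[2⟨u⟩_5 < 5] = Σ_a G₂(a)·[2⟨ua⟩ < 15]` for every unit `u` of `ℤ/15`,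
`G₂ = δ_2 + δ_7 + δ_{11} − δ_{14}` (so `2δ_{(5,1)}`, hence every `2δ_z`, lies in `ℤ[E_15] + {equations}`: the index is AT MOST `2`).
[cite: Goodson2024DegeneracyFermat, §5.2.1 Prop. 5.4 («an index-2 submodule»)] -/
theorem decide_exists_two_mul_table :
    ∃ G₂ : ℕ → ℤ, ∀ u ∈ ({1, 2, 4, 7, 8, 11, 13, 14} : Finset ℕ),
      (2 * (if 2 * (u % 5) < 5 then 1 else 0) : ℤ) =
        ∑ a ∈ ({1, 2, 4, 7, 8, 11, 13, 14} : Finset ℕ), G₂ a * (if 2 * ((u * a) % 15) < 15 then 1 else 0) := by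
  refine ⟨fun a => if a = 2 then 1 else if a = 7 then 1 else if a = 11 then 1 else if a = 14 then -1 else 0, ?_⟩
  decide

end Kernels

/-! ## §2 From embeddings to residues: the pairing `⟨g, w_τ⟩` and the coordinates `v_τ(z)` as functions of `u(τ) ∈ (ℤ/15)ˣ` -/

section Plumbing

open Literature.NumberTheory.ComplexMultiplication
open Literature.AlgebraicGeometry.Motives (CMType)
open Literature.AlgebraicGeometry.Pohlmann1968 Literature.AlgebraicGeometry.Pohlmann1968.Cyclotomic
open Literature.AlgebraicGeometry.Pohlmann1968.CMAlgebra
open scoped Literature.NumberTheory.ComplexMultiplication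

/-- **Sums over the embeddings of `ℚ(ζ_N)` are sums over the units of `ℤ/N`** (read on exponents `e(x) ∈ (ℤ/N)ˣ`,
`Hom(ℚ(ζ_N), ℂ) ≅ (ℤ/Nℤ)ˣ`). [cite: Washington1997, Thm. 2.5] -/
theorem sum_embeddings_eq_sum_filter_coprime (N : ℕ) [NeZero N] (L : Type) [Field L] [NumberField L]
    [IsCyclotomicExtension {N} ℚ L] {R : Type*} [AddCommMonoid R] (F : ℕ → R) :
    ∑ x : L →+* ℂ, F (expOf N L x).val = ∑ a ∈ (Finset.range N).filter fun a => a.Coprime N, F a := by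
  classical
  refine Finset.sum_bij (fun x _ => (expOf N L x).val) (fun x _ => ?_) (fun x _ x' _ h => ?_) (fun a ha => ?_) (fun _ _ => rfl)
  · exact Finset.mem_filter.2 ⟨Finset.mem_range.2 (ZMod.val_lt _), coprime_expOf N L x⟩
  · exact expOf_injective N L (ZMod.val_injective N h)
  · obtain ⟨ha, hcop⟩ := Finset.mem_filter.1 ha
    have hval : ((a : ℕ) : ZMod N).val = a := ZMod.val_natCast_of_lt (Finset.mem_range.1 ha)
    obtain ⟨x, hx⟩ := exists_expOf_eq N L (a : ZMod N) (by rw [hval]; exact hcop)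
    exact ⟨x, Finset.mem_univ _, by rw [hx, hval]⟩

variable {k : ℕ} {lev : Fin k → ℕ} [∀ i, NeZero (lev i)] {K : Fin k → Type} [∀ i, Field (K i)]
  [∀ i, NumberField (K i)] [∀ i, IsCyclotomicExtension {lev i} ℚ (K i)] {Φ : ∀ i, CMType (K i)} {i₀ : Fin k}

/-- `(u mod d · b) mod d = (u·b) mod d`. [folklore] -/
private theorem mod_mul_mod (u b d : ℕ) : u % d * b % d = u * b % d := by
  rw [Nat.mul_mod, Nat.mod_mod, ← Nat.mul_mod]

/-- **The coordinates of the translates on exponents, relative to the top character `u = u_{d₀}(τ)`**: for a level `d_i ∣ d₀`,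
`v_τ(i, σ) = [2·((u·e(σ)) mod d_i) < d_i]` (the characters are compatible: `u_{d_i}(τ) = u mod d_i`).
[cite: Goodson2024DegeneracyFermat, §5.2.1 (the rows `τ_j` of the matrices `M_i`)] -/
theorem translateInd_familyType_eq_ite_val (hdvd : ∀ i, lev i ∣ lev i₀)
    (hΦ : ∀ i (σ : K i →+* ℂ), σ ∈ (Φ i).1 ↔ 2 * (expOf (lev i) (K i) σ).val < lev i)
    (τ : ℂ ≃+* ℂ) (z : (i : Fin k) × (K i →+* ℂ)) :
    translateInd (familyType Φ) τ z =
      if 2 * ((autExp (lev i₀) τ).val * (expOf (lev z.1) (K z.1) z.2).val % lev z.1) < lev z.1 then 1 else 0 := by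
  rw [translateInd_familyType_eq_ite hΦ, ZMod.val_mul, ← castHom_autExp (lev z.1) (lev i₀) (hdvd z.1) τ,
    ZMod.castHom_apply, ZMod.cast_eq_val, ZMod.val_natCast, mod_mul_mod]

/-- The same for the top factor read on its own CM type: `w_τ(x) = [2·((u·e(x)) mod d₀) < d₀]`.
[cite: Goodson2024DegeneracyFermat, §5.2.1 (the matrix `M_1`)] -/
theorem translateInd_top_eq_ite_val (hΦ : ∀ i (σ : K i →+* ℂ), σ ∈ (Φ i).1 ↔ 2 * (expOf (lev i) (K i) σ).val < lev i)
    (τ : ℂ ≃+* ℂ) (x : K i₀ →+* ℂ) :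
    translateInd (Φ i₀).1 τ x =
      if 2 * ((autExp (lev i₀) τ).val * (expOf (lev i₀) (K i₀) x).val % lev i₀) < lev i₀ then 1 else 0 := by
  rw [← CMAlgebra.translateInd_familyType Φ τ ⟨i₀, x⟩, translateInd_familyType_eq_ite hΦ, ZMod.val_mul]

/-- **The pairing of a top character given on exponents with a translate**: for `g(x) = F(e(x))`,
`⟨g, w_τ⟩ = Σ_{a ∈ (ℤ/15)ˣ} F(a)·[2((u·a) mod 15) < 15]`, `u = u_{15}(τ)`. [cite: Goodson2024DegeneracyFermat, §5.2.1 (the matrix `M_1`)] -/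
theorem sum_top_pairing_eq (hi₀ : lev i₀ = 15)
    (hΦ : ∀ i (σ : K i →+* ℂ), σ ∈ (Φ i).1 ↔ 2 * (expOf (lev i) (K i) σ).val < lev i)
    (F : ℕ → ℤ) (τ : ℂ ≃+* ℂ) :
    ∑ x : K i₀ →+* ℂ, (F (expOf (lev i₀) (K i₀) x).val : ℚ) * translateInd (Φ i₀).1 τ x =
      ∑ a ∈ ({1, 2, 4, 7, 8, 11, 13, 14} : Finset ℕ),
        (F a : ℚ) * (if 2 * ((autExp (lev i₀) τ).val * a % 15) < 15 then 1 else 0) := by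
  simp only [translateInd_top_eq_ite_val hΦ]
  rw [← filter_coprime_fifteen, ← hi₀]
  exact sum_embeddings_eq_sum_filter_coprime (lev i₀) (K i₀)
    (fun a => (F a : ℚ) * (if 2 * ((autExp (lev i₀) τ).val * a % lev i₀) < lev i₀ then 1 else 0))

/-- The top character `u_{15}(τ)`, as a natural number, is one of the eight units. [folklore] -/
private theorem val_autExp_mem (hi₀ : lev i₀ = 15) (τ : ℂ ≃+* ℂ) :
    (autExp (lev i₀) τ).val ∈ ({1, 2, 4, 7, 8, 11, 13, 14} : Finset ℕ) := by
  rw [← filter_coprime_fifteen, Finset.mem_filter, Finset.mem_range]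
  have h1 := ZMod.val_lt (autExp (lev i₀) τ)
  have h2 := coprime_autExp (lev i₀) τ
  generalize (autExp (lev i₀) τ).val = u at h1 h2 ⊢
  rw [hi₀] at h1 h2
  exact ⟨h1, h2⟩

omit [∀ i, NeZero (lev i)] [∀ i, NumberField (K i)] [∀ i, IsCyclotomicExtension {lev i} ℚ (K i)] in
/-- A level of the `J_{15}` family other than `15` is `3` or `5`. [folklore] -/
private theorem lev_eq_three_or_five (hdvd : ∀ i, lev i ∣ 15) (h1 : ∀ i, 1 < lev i) {i : Fin k} (hi : lev i ≠ 15) :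
    lev i = 3 ∨ lev i = 5 := by
  have hle : lev i ≤ 15 := Nat.le_of_dvd (by norm_num) (hdvd i)
  have hd := hdvd i
  have h1i := h1 i
  interval_cases h : lev i <;> simp_all

/-- The lower coordinate `(d, e(y))` is one of the six pairs `(3,1), (3,2), (5,1), …, (5,4)`. [folklore] -/
private theorem level_pair_mem (hdvd : ∀ i, lev i ∣ 15) (h1 : ∀ i, 1 < lev i) {i : Fin k} (hi : lev i ≠ 15)
    (y : K i →+* ℂ) :
    (lev i, (expOf (lev i) (K i) y).val) ∈ ({(3, 1), (3, 2), (5, 1), (5, 2), (5, 3), (5, 4)} : Finset (ℕ × ℕ)) := by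
  have hb := ZMod.val_lt (expOf (lev i) (K i) y)
  have hcop := coprime_expOf (lev i) (K i) y
  generalize (expOf (lev i) (K i) y).val = b at hb hcop ⊢
  rcases lev_eq_three_or_five hdvd h1 hi with h | h <;> rw [h] at hb hcop ⊢ <;>
    interval_cases b <;> simp_all (config := {decide := true})

/-- The top coordinates with the level written as `15`: `w_τ(x) = [2((u·e(x)) mod 15) < 15]`. [cite: Goodson2024DegeneracyFermat, §5.2.1 (the matrix `M_1`)] -/
theorem translateInd_top_eq_ite_fifteen (hi₀ : lev i₀ = 15)
    (hΦ : ∀ i (σ : K i →+* ℂ), σ ∈ (Φ i).1 ↔ 2 * (expOf (lev i) (K i) σ).val < lev i)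
    (τ : ℂ ≃+* ℂ) (x : K i₀ →+* ℂ) :
    translateInd (Φ i₀).1 τ x =
      if 2 * ((autExp (lev i₀) τ).val * (expOf (lev i₀) (K i₀) x).val % 15) < 15 then 1 else 0 := by
  rw [translateInd_top_eq_ite_val hΦ]
  generalize (autExp (lev i₀) τ).val * (expOf (lev i₀) (K i₀) x).val = n
  rw [hi₀]

/-- The exponent of an embedding of the top field `ℚ(ζ₁₅)`, as a natural number, is one of the eight units. [folklore] -/
private theorem val_expOf_mem (hi₀ : lev i₀ = 15) (x : K i₀ →+* ℂ) :
    (expOf (lev i₀) (K i₀) x).val ∈ ({1, 2, 4, 7, 8, 11, 13, 14} : Finset ℕ) := by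
  rw [← filter_coprime_fifteen, Finset.mem_filter, Finset.mem_range]
  have h1 := ZMod.val_lt (expOf (lev i₀) (K i₀) x)
  have h2 := coprime_expOf (lev i₀) (K i₀) x
  generalize (expOf (lev i₀) (K i₀) x).val = u at h1 h2 ⊢
  rw [hi₀] at h1 h2
  exact ⟨h1, h2⟩

/-- Automorphisms of `ℂ` with top character `u ∈ {1, 2, 4, 7}` exist. [folklore] -/
private theorem exists_autExp_val_eq (hi₀ : lev i₀ = 15) {j : ℕ} (hj : j ∈ ({1, 2, 4, 7} : Finset ℕ)) :
    ∃ τ : ℂ ≃+* ℂ, (autExp (lev i₀) τ).val = j := by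
  have hj15 : j < 15 ∧ j.Coprime 15 := by
    simp only [Finset.mem_insert, Finset.mem_singleton] at hj
    rcases hj with rfl | rfl | rfl | rfl <;> decide
  have hval : ((j : ℕ) : ZMod (lev i₀)).val = j := ZMod.val_natCast_of_lt (by rw [hi₀]; exact hj15.1)
  obtain ⟨τ, hτ⟩ := exists_autExp_eq (lev i₀) (j : ZMod (lev i₀)) (by rw [hval, hi₀]; exact hj15.2)
  exact ⟨τ, by rw [hτ, hval]⟩

end Plumbing

/-! ## §3 PROPOSITION 5.4: the index of `ℤ[E_{15}] + {equations}` in `ℤ[⊔_d Hom(ℚ(ζ_d), ℂ)]` is EXACTLY `2` -/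

section IndexTwo

open Literature.NumberTheory.ComplexMultiplication
open Literature.AlgebraicGeometry.Motives (CMType)
open Literature.AlgebraicGeometry.Pohlmann1968 Literature.AlgebraicGeometry.Pohlmann1968.Cyclotomic
open Literature.AlgebraicGeometry.Pohlmann1968.CMAlgebra
open scoped Literature.NumberTheory.ComplexMultiplication

variable {k : ℕ} {lev : Fin k → ℕ} [∀ i, NeZero (lev i)] {K : Fin k → Type} [∀ i, Field (K i)]
  [∀ i, NumberField (K i)] [∀ i, IsCyclotomicExtension {lev i} ℚ (K i)] {Φ : ∀ i, CMType (K i)} {i₀ : Fin k}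

/-- **NOT AN ISOMORPHISM (the index is at least `2`).**  On the CM data of `J_{15} ∼ X_{15} × J_5 × J_3` (lower-half types at levels
`1 < d_i ∣ 15`, one of them `15`): for EVERY embedding `z` of a LOWER factor (`ℚ(ζ_5)` or `ℚ(ζ_3)`), the coordinate character `δ_z`
is NOT represented on the top factor — there is no `g : Hom(ℚ(ζ_{15}), ℂ) → ℤ` with `[τ∘z ∈ Σ] = ⟨g, w_τ⟩` for all `τ ∈ Aut(ℂ)`; i.e.
`δ_z ∉ ℤ[E_{15}] + {equations}`, the map `X^*(MT(X_{15})) → X^*(MT(J_{15}))` is NOT surjective: «for `m = 15` … the projection of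
the Mumford–Tate group is an isogeny, not an isomorphism».  Proof: the mod-`2` obstruction — summed over the four automorphisms of
character `u ∈ {1, 2, 4, 7}`, every top coordinate is covered an even number of times (`decide_top_cover_even`) and every lower
one an odd number of times (`decide_lower_cover_odd`).  (Contrast `exists_top_character_of_isPrimePow`: for `m = p^k` every `δ_z`
IS represented.)  [cite: GalleseGoodsonLombardo2024, §1 «Results in families» (the remark on `m = 15`)]
[cite: Goodson2024DegeneracyFermat, §5.2.1 Prop. 5.4] -/
theorem not_exists_top_character_fifteen (hdvd : ∀ i, lev i ∣ 15) (hi₀ : lev i₀ = 15) (h1 : ∀ i, 1 < lev i)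
    (hΦ : ∀ i (σ : K i →+* ℂ), σ ∈ (Φ i).1 ↔ 2 * (expOf (lev i) (K i) σ).val < lev i)
    (z : (i : Fin k) × (K i →+* ℂ)) (hz : lev z.1 ≠ 15) :
    ¬∃ g : (K i₀ →+* ℂ) → ℤ, ∀ τ : ℂ ≃+* ℂ,
        translateInd (familyType Φ) τ z = ∑ x, (g x : ℚ) * translateInd (Φ i₀).1 τ x := by
  rintro ⟨g, hg⟩
  have hdvd' : ∀ i, lev i ∣ lev i₀ := fun i => by rw [hi₀]; exact hdvd i
  obtain ⟨i, y⟩ := z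
  -- the equation at an automorphism of top character `j`, read on residues
  have key : ∀ j ∈ ({1, 2, 4, 7} : Finset ℕ),
      ((if 2 * (j * (expOf (lev i) (K i) y).val % lev i) < lev i then 1 else 0 : ℕ) : ℚ) =
        ∑ x : K i₀ →+* ℂ, (g x : ℚ) *
          ((if 2 * (j * (expOf (lev i₀) (K i₀) x).val % 15) < 15 then 1 else 0 : ℕ) : ℚ) := by
    intro j hj
    obtain ⟨τ, hτ⟩ := exists_autExp_val_eq hi₀ hj
    have h := hg τ
    rw [translateInd_familyType_eq_ite_val hdvd' hΦ, hτ] at h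
    simp only [translateInd_top_eq_ite_fifteen hi₀ hΦ, hτ] at h
    push_cast
    exact h
  have e1 := key 1 (by simp)
  have e2 := key 2 (by simp)
  have e4 := key 4 (by simp)
  have e7 := key 7 (by simp)
  -- every top coordinate is covered an even number of times
  have heven : ∀ x : K i₀ →+* ℂ,
      (((if 2 * (1 * (expOf (lev i₀) (K i₀) x).val % 15) < 15 then 1 else 0) +
          (if 2 * (2 * (expOf (lev i₀) (K i₀) x).val % 15) < 15 then 1 else 0) +
          (if 2 * (4 * (expOf (lev i₀) (K i₀) x).val % 15) < 15 then 1 else 0) +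
          (if 2 * (7 * (expOf (lev i₀) (K i₀) x).val % 15) < 15 then 1 else 0) : ℕ) : ℚ) =
        2 * (((((if 2 * (1 * (expOf (lev i₀) (K i₀) x).val % 15) < 15 then 1 else 0) +
          (if 2 * (2 * (expOf (lev i₀) (K i₀) x).val % 15) < 15 then 1 else 0) +
          (if 2 * (4 * (expOf (lev i₀) (K i₀) x).val % 15) < 15 then 1 else 0) +
          (if 2 * (7 * (expOf (lev i₀) (K i₀) x).val % 15) < 15 then 1 else 0) : ℕ) / 2 : ℕ) : ℤ) : ℚ) := by
    intro x
    exact_mod_cast decide_top_cover_even _ (val_expOf_mem hi₀ x)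
  -- the lower coordinate is covered an odd number of times
  have hodd := decide_lower_cover_odd _ (level_pair_mem hdvd h1 hz y)
  dsimp only at hodd
  -- sum the four equations
  set O : ℕ := (if 2 * (1 * (expOf (lev i) (K i) y).val % lev i) < lev i then 1 else 0) +
      (if 2 * (2 * (expOf (lev i) (K i) y).val % lev i) < lev i then 1 else 0) +
      (if 2 * (4 * (expOf (lev i) (K i) y).val % lev i) < lev i then 1 else 0) +
      (if 2 * (7 * (expOf (lev i) (K i) y).val % lev i) < lev i then 1 else 0) with hO
  set M : ℤ := (∑ x : K i₀ →+* ℂ, g x *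
      ((((if 2 * (1 * (expOf (lev i₀) (K i₀) x).val % 15) < 15 then 1 else 0) +
          (if 2 * (2 * (expOf (lev i₀) (K i₀) x).val % 15) < 15 then 1 else 0) +
          (if 2 * (4 * (expOf (lev i₀) (K i₀) x).val % 15) < 15 then 1 else 0) +
          (if 2 * (7 * (expOf (lev i₀) (K i₀) x).val % 15) < 15 then 1 else 0) : ℕ) / 2 : ℕ) : ℤ)) with hM
  have htot : ((O : ℕ) : ℚ) = 2 * ((M : ℤ) : ℚ) := by
    rw [hO, hM]
    push_cast at e1 e2 e4 e7 ⊢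
    rw [e1, e2, e4, e7, ← Finset.sum_add_distrib, ← Finset.sum_add_distrib, ← Finset.sum_add_distrib, Finset.mul_sum]
    refine Finset.sum_congr rfl fun x _ => ?_
    have hx := heven x
    push_cast at hx
    linear_combination (g x : ℚ) * hx
  have hint : (O : ℤ) = 2 * M := by exact_mod_cast htot
  omega

/-- **The rows of the representation.**  There is an integral table `R(z, ·)` on `Hom(ℚ(ζ_{15}), ℂ)`, `z ∈ ⊔_d Hom(ℚ(ζ_d), ℂ)`, with
`⟨R(z,·), w_τ⟩ = v_τ(z)` for top `z` and `⟨R(z,·), w_τ⟩ = v_τ(z) − v_τ(z₀)` for lower `z` (`z₀` a fixed lower embedding): every top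
`δ_z`, and every DIFFERENCE of two lower `δ`'s, lies in `ℤ[E_{15}] + {equations}` (`decide_exists_lower_sub_table`).
[cite: Goodson2024DegeneracyFermat, §5.2.1 Prop. 5.4 (the kernel of `M`)] -/
theorem exists_rows_fifteen (hdvd : ∀ i, lev i ∣ 15) (hi₀ : lev i₀ = 15) (h1 : ∀ i, 1 < lev i)
    (hinj : Function.Injective lev)
    (hΦ : ∀ i (σ : K i →+* ℂ), σ ∈ (Φ i).1 ↔ 2 * (expOf (lev i) (K i) σ).val < lev i)
    (z₀ : (i : Fin k) × (K i →+* ℂ)) (hz₀ : lev z₀.1 ≠ 15) :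
    ∃ R : ((i : Fin k) × (K i →+* ℂ)) → (K i₀ →+* ℂ) → ℤ, ∀ (τ : ℂ ≃+* ℂ) (z : (i : Fin k) × (K i →+* ℂ)),
      ∑ x, (R z x : ℚ) * translateInd (Φ i₀).1 τ x =
        translateInd (familyType Φ) τ z - if lev z.1 = 15 then 0 else translateInd (familyType Φ) τ z₀ := by
  classical
  have hdvd' : ∀ i, lev i ∣ lev i₀ := fun i => by rw [hi₀]; exact hdvd i
  obtain ⟨G, hG⟩ := decide_exists_lower_sub_table
  refine ⟨fun z x => if lev z.1 = 15 then
      (if (expOf (lev z.1) (K z.1) z.2).val = (expOf (lev i₀) (K i₀) x).val then 1 else 0)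
    else G (lev z.1) (expOf (lev z.1) (K z.1) z.2).val (expOf (lev i₀) (K i₀) x).val -
      G (lev z₀.1) (expOf (lev z₀.1) (K z₀.1) z₀.2).val (expOf (lev i₀) (K i₀) x).val, fun τ z => ?_⟩
  obtain ⟨i, σ⟩ := z
  dsimp only
  by_cases htop : lev i = 15
  · -- a top coordinate: `z = (i₀, σ)` and `⟨δ_σ, w_τ⟩ = w_τ(σ)`
    have hi : i = i₀ := hinj (htop.trans hi₀.symm)
    subst hi
    simp only [if_pos htop, sub_zero, CMAlgebra.translateInd_familyType]
    rw [Finset.sum_eq_single σ]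
    · simp
    · intro x _ hx
      have hne : (expOf (lev i) (K i) σ).val ≠ (expOf (lev i) (K i) x).val := fun h =>
        hx (expOf_injective (lev i) (K i) (ZMod.val_injective _ h)).symm
      simp [hne]
    · intro h
      exact absurd (Finset.mem_univ σ) h
  · -- a lower coordinate: the table
    simp only [if_neg htop]
    have hF := sum_top_pairing_eq hi₀ hΦ (fun a => G (lev i) (expOf (lev i) (K i) σ).val a -
      G (lev z₀.1) (expOf (lev z₀.1) (K z₀.1) z₀.2).val a) τ
    beta_reduce at hF
    push_cast at hF ⊢
    rw [hF, translateInd_familyType_eq_ite_val hdvd' hΦ τ ⟨i, σ⟩, translateInd_familyType_eq_ite_val hdvd' hΦ τ z₀]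
    dsimp only
    have hu := val_autExp_mem hi₀ τ
    have h1' := hG _ (level_pair_mem hdvd h1 htop σ) _ hu
    have h2' := hG _ (level_pair_mem hdvd h1 hz₀ z₀.2) _ hu
    dsimp only at h1' h2'
    have h1q := congrArg (Int.cast : ℤ → ℚ) h1'
    have h2q := congrArg (Int.cast : ℤ → ℚ) h2'
    push_cast at h1q h2q
    simp only [sub_mul, Finset.sum_sub_distrib]
    linear_combination h1q.symm - h2q.symm

/-- **Twice a lower coordinate is represented** (`2δ_{z₀} ∈ ℤ[E_{15}] + {equations}`: the index is AT MOST `2`).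
[cite: Goodson2024DegeneracyFermat, §5.2.1 Prop. 5.4 («an index-2 submodule»)] -/
theorem exists_top_character_two_mul_fifteen (hdvd : ∀ i, lev i ∣ 15) (hi₀ : lev i₀ = 15) (h1 : ∀ i, 1 < lev i)
    (hΦ : ∀ i (σ : K i →+* ℂ), σ ∈ (Φ i).1 ↔ 2 * (expOf (lev i) (K i) σ).val < lev i)
    (z₀ : (i : Fin k) × (K i →+* ℂ)) (hz₀ : lev z₀.1 ≠ 15) :
    ∃ T : (K i₀ →+* ℂ) → ℤ, ∀ τ : ℂ ≃+* ℂ,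
      ∑ x, (T x : ℚ) * translateInd (Φ i₀).1 τ x = 2 * translateInd (familyType Φ) τ z₀ := by
  have hdvd' : ∀ i, lev i ∣ lev i₀ := fun i => by rw [hi₀]; exact hdvd i
  obtain ⟨G, hG⟩ := decide_exists_lower_sub_table
  obtain ⟨G₂, hG₂⟩ := decide_exists_two_mul_table
  refine ⟨fun x => G₂ (expOf (lev i₀) (K i₀) x).val +
    2 * G (lev z₀.1) (expOf (lev z₀.1) (K z₀.1) z₀.2).val (expOf (lev i₀) (K i₀) x).val, fun τ => ?_⟩
  have hF := sum_top_pairing_eq hi₀ hΦ (fun a => G₂ a +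
    2 * G (lev z₀.1) (expOf (lev z₀.1) (K z₀.1) z₀.2).val a) τ
  beta_reduce at hF ⊢
  push_cast at hF ⊢
  rw [hF, translateInd_familyType_eq_ite_val hdvd' hΦ τ z₀]
  have hu := val_autExp_mem hi₀ τ
  have h1' := hG _ (level_pair_mem hdvd h1 hz₀ z₀.2) _ hu
  have h2' := hG₂ _ hu
  dsimp only at h1' h2'
  have h1q := congrArg (Int.cast : ℤ → ℚ) h1'
  have h2q := congrArg (Int.cast : ℤ → ℚ) h2'
  push_cast at h1q h2q
  simp only [add_mul, Finset.sum_add_distrib, mul_assoc, ← Finset.mul_sum]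
  linear_combination h2q.symm + 2 * h1q.symm

/-- **PROPOSITION 5.4 (Goodson): «The canonical projection `MT(J_{15}) → X` is a degree `2` isogeny» — the index of
`ℤ[E_{15}] + {equations}` in `ℤ[E_{15}] × ℤ[E_5] × ℤ[E_3]` is EXACTLY `2`.**  On the CM data of `J_{15} ∼ X_{15} × J_5 × J_3` (lower-half
types at distinct levels `1 < d_i ∣ 15`, one of them `15`, at least one lower factor present): for any fixed lower embedding `z₀`,
EVERY integral character `f` of `⊔_i Hom(ℚ(ζ_{d_i}), ℂ)` is congruent modulo the equations either to a top character or to a top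
character plus `δ_{z₀}` — `∃ g`, `⟨f, v_τ⟩ = ⟨g, w_τ⟩ ∀τ` or `⟨f, v_τ⟩ = ⟨g, w_τ⟩ + v_τ(z₀) ∀τ` — while `δ_{z₀}` itself is in neither
class's complement… i.e. is NOT a top character modulo equations (`not_exists_top_character_fifteen`): the quotient
`ℤ[S] / (ℤ[E_{15}] + {equations}) = coker(X^*(MT X_{15}) → X^*(MT J_{15}))` is `ℤ/2`, generated by `δ_{z₀}` — «the space spanned by
kernel of `M` and `ℤ⁸ × {0} × {0}` is an index-2 submodule of `ℤ⁸ × ℤ⁴ × ℤ²` … Thus, by Lemma 3.2, the projection is a degree 2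
isogeny» (there by Sage; here `decide` on the residues: the table `decide_exists_lower_sub_table`, `decide_exists_two_mul_table`).
[cite: Goodson2024DegeneracyFermat, §5.2.1 Prop. 5.4 and §3.1.2 Lemma 3.2] [cite: GalleseGoodsonLombardo2024, §1 «Results in families»] -/
theorem exists_top_character_or_fifteen (hdvd : ∀ i, lev i ∣ 15) (hi₀ : lev i₀ = 15) (h1 : ∀ i, 1 < lev i)
    (hinj : Function.Injective lev)
    (hΦ : ∀ i (σ : K i →+* ℂ), σ ∈ (Φ i).1 ↔ 2 * (expOf (lev i) (K i) σ).val < lev i)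
    (z₀ : (i : Fin k) × (K i →+* ℂ)) (hz₀ : lev z₀.1 ≠ 15) (f : ((i : Fin k) × (K i →+* ℂ)) → ℤ) :
    ∃ g : (K i₀ →+* ℂ) → ℤ,
      (∀ τ : ℂ ≃+* ℂ, ∑ z, (f z : ℚ) * translateInd (familyType Φ) τ z = ∑ x, (g x : ℚ) * translateInd (Φ i₀).1 τ x) ∨
      (∀ τ : ℂ ≃+* ℂ, ∑ z, (f z : ℚ) * translateInd (familyType Φ) τ z =
        (∑ x, (g x : ℚ) * translateInd (Φ i₀).1 τ x) + translateInd (familyType Φ) τ z₀) := by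
  classical
  obtain ⟨R, hR⟩ := exists_rows_fifteen hdvd hi₀ h1 hinj hΦ z₀ hz₀
  obtain ⟨T, hT⟩ := exists_top_character_two_mul_fifteen hdvd hi₀ h1 hΦ z₀ hz₀
  -- the total weight of `f` on the lower coordinates, `s = 2q + ε`
  set s : ℤ := (∑ z ∈ Finset.univ.filter (fun z : (i : Fin k) × (K i →+* ℂ) => ¬lev z.1 = 15), f z) with hs
  have hqε : s = 2 * (s / 2) + s % 2 := by omega
  have hε : s % 2 = 0 ∨ s % 2 = 1 := by omega
  -- the common computation: `⟨g, w_τ⟩ = ⟨f, v_τ⟩ − ε·v_τ(z₀)` for `g = Σ_z f(z) R(z,·) + q·T`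
  have main : ∀ τ : ℂ ≃+* ℂ,
      ∑ x, ((∑ z, f z * R z x + (s / 2) * T x : ℤ) : ℚ) * translateInd (Φ i₀).1 τ x =
        (∑ z, (f z : ℚ) * translateInd (familyType Φ) τ z) - (s % 2 : ℤ) * translateInd (familyType Φ) τ z₀ := by
    intro τ
    have hlow : ∑ z, (f z : ℚ) * (if lev z.1 = 15 then 0 else translateInd (familyType Φ) τ z₀) =
        (s : ℚ) * translateInd (familyType Φ) τ z₀ := by
      rw [hs]
      push_cast
      rw [Finset.sum_mul, Finset.sum_filter]
      refine Finset.sum_congr rfl fun z _ => ?_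
      split_ifs <;> simp
    calc ∑ x, ((∑ z, f z * R z x + (s / 2) * T x : ℤ) : ℚ) * translateInd (Φ i₀).1 τ x
        = ∑ z, (f z : ℚ) * (∑ x, (R z x : ℚ) * translateInd (Φ i₀).1 τ x) +
            ((s / 2 : ℤ) : ℚ) * ∑ x, (T x : ℚ) * translateInd (Φ i₀).1 τ x := by
          push_cast
          simp only [add_mul, Finset.sum_add_distrib, Finset.sum_mul, Finset.mul_sum]
          rw [Finset.sum_comm]
          congr 1
          · exact Finset.sum_congr rfl fun z _ => Finset.sum_congr rfl fun x _ => by ring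
          · exact Finset.sum_congr rfl fun x _ => by ring
      _ = ∑ z, (f z : ℚ) * (translateInd (familyType Φ) τ z -
              if lev z.1 = 15 then 0 else translateInd (familyType Φ) τ z₀) +
            ((s / 2 : ℤ) : ℚ) * (2 * translateInd (familyType Φ) τ z₀) := by
          simp only [hR, hT]
      _ = (∑ z, (f z : ℚ) * translateInd (familyType Φ) τ z) - (s % 2 : ℤ) * translateInd (familyType Φ) τ z₀ := by
          simp only [mul_sub, Finset.sum_sub_distrib, hlow]
          have h2 : ((s / 2 : ℤ) : ℚ) * 2 = (s : ℚ) - ((s % 2 : ℤ) : ℚ) := by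
            have := congrArg (Int.cast : ℤ → ℚ) hqε
            push_cast at this ⊢
            linarith
          linear_combination translateInd (familyType Φ) τ z₀ * h2
  refine ⟨fun x => ∑ z, f z * R z x + (s / 2) * T x, ?_⟩
  rcases hε with h0 | h1'
  · left
    intro τ
    rw [main τ, h0]
    simp
  · right
    intro τ
    rw [main τ, h1']
    simp

/-- **THE DEGREE-`2` ISOGENY `MT(J_{15}) → MT(X_{15})`, both halves**: on the CM data of `J_{15} ∼ X_{15} × J_5 × J_3`, for any lower
embedding `z₀`: (i) `δ_{z₀}` is not a top character modulo the equations (the projection is NOT an isomorphism), and (ii) every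
integral character is a top character modulo the equations up to adding `δ_{z₀}` at most once (the cokernel of
`X^*(MT X_{15}) → X^*(MT J_{15})`, i.e. the kernel of `MT(J_{15}) → MT(X_{15})`, has order EXACTLY `2`).  Compare the prime powers
(`exists_top_character_of_isPrimePow`: order `1`) and the ranks (`cmFamilyRank_eq_cmTypeRank_fifteen`: an isogeny).
[cite: Goodson2024DegeneracyFermat, §5.2.1 Prop. 5.4] [cite: GalleseGoodsonLombardo2024, §1 «Results in families» (the remark on `m = 15`)] -/
theorem index_two_fifteen (hdvd : ∀ i, lev i ∣ 15) (hi₀ : lev i₀ = 15) (h1 : ∀ i, 1 < lev i)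
    (hinj : Function.Injective lev)
    (hΦ : ∀ i (σ : K i →+* ℂ), σ ∈ (Φ i).1 ↔ 2 * (expOf (lev i) (K i) σ).val < lev i)
    (z₀ : (i : Fin k) × (K i →+* ℂ)) (hz₀ : lev z₀.1 ≠ 15) :
    (¬∃ g : (K i₀ →+* ℂ) → ℤ, ∀ τ : ℂ ≃+* ℂ,
        translateInd (familyType Φ) τ z₀ = ∑ x, (g x : ℚ) * translateInd (Φ i₀).1 τ x) ∧
    ∀ f : ((i : Fin k) × (K i →+* ℂ)) → ℤ, ∃ g : (K i₀ →+* ℂ) → ℤ,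
      (∀ τ : ℂ ≃+* ℂ, ∑ z, (f z : ℚ) * translateInd (familyType Φ) τ z = ∑ x, (g x : ℚ) * translateInd (Φ i₀).1 τ x) ∨
      (∀ τ : ℂ ≃+* ℂ, ∑ z, (f z : ℚ) * translateInd (familyType Φ) τ z =
        (∑ x, (g x : ℚ) * translateInd (Φ i₀).1 τ x) + translateInd (familyType Φ) τ z₀) :=
  ⟨not_exists_top_character_fifteen hdvd hi₀ h1 hΦ z₀ hz₀,
    exists_top_character_or_fifteen hdvd hi₀ h1 hinj hΦ z₀ hz₀⟩

end IndexTwo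

end HyperellipticJacobian

end Literature.AlgebraicGeometry.ComplexMultiplication
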